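import Mathlib.AlgebraicGeometry.EllipticCurve.Affine.Point
import Mathlib.Analysis.SpecialFunctions.Pow.Real
import HarnessLib

/-!
# Transport of Greenberg's «odd» type along isogenies, I: algebra of the 2-division cubic and the
# doubling formula (line `nsf` on crux `StarOptBNSF`, item stmt-BirchSwinnertonDyer-27047, stub
# `stub_regimeTransport` — archimedean half of «odd-degree isogenies preserve both type bits»)

Lead bsd-rank2-star-p1 GEN 7.  Elementary identities for the 2-division cubic
`f(r) = 4r³ + b₂r² + 2b₄r + b₆` of a Weierstrass curve around a root `x` (a 2-torsion abscissa):

* `cubic_shift` — `f(x + t) = f(x) + t(4t² + αt + 2β)`, `α = b₂ + 12x`, `β = b₄ + x b₂ + 6x²` (the tree's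
  sign data of `Greenberg1999/TwoTorsionOddCriterionProofs`);
* `duplication_identity` / `addX_self_eq_iff` — the doubling formula in the form
  `x(R + R) = x ⟺ 2(x(R) − x)² = β` (the halves of the 2-torsion point `(x, ·)` have abscissae
  `x ± √(β/2)`), from Mathlib's `addX`/`slope` and `(2s + a₁r + a₃)² = f(r)`;
* `least_root_of_neg_at_half` — if `2t² = β` and `f(x + t) < 0` then `x` is the LEAST real root of `f`
  (`TwoTorsionOdd`), by `(α + 8t)(−τ) = 4(τ − t)²` against `f(x + t) = t²(α + 8t)`;
* `eq_of_equation_of_two_torsion` — a point with the abscissa of a 2-torsion point is that point.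

Consumed by `…OddTransportArchHalves` (odd ⟺ an anti-real half exists in `E(ℂ)`) and `…OddTransportArch`
(transport along a `ℚ`-isogeny).  HONEST FRAMING: elementary algebra under an OPEN crux; nothing here reads
an analytic rank; `StarOptBNSF` / `E1M_NSF` / BSD are NOT proved by it.

References: J. H. Silverman, *AEC*, GTM 106 (2009), III.2.3 (group law, duplication formula)
[SilvermanAEC2009]; R. Greenberg, LNM 1716 (1999), §5 p. 168, Remark p. 174 [GreenbergLNM1716].
-/

set_option linter.dupNamespace false
set_option autoImplicit false

noncomputable section

open scoped Classical
open WeierstrassCurve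

namespace Summit.BirchSwinnertonDyer.BirchSwinnertonDyer.Theorems.DepletionAtTwo.ArchTransport

/-! ### §0 Real algebra of the 2-division cubic around a root -/

/-- Taylor expansion of the 2-division cubic `f(r) = 4r³ + b₂r² + 2b₄r + b₆` at `x`:
`f(x + t) = f(x) + t·(4t² + (b₂ + 12x)t + 2(b₄ + x b₂ + 6x²))`. [folklore] -/
theorem cubic_shift {R : Type*} [CommRing R] (b₂ b₄ b₆ x t : R) :
    4 * (x + t) ^ 3 + b₂ * (x + t) ^ 2 + 2 * b₄ * (x + t) + b₆ =
      (4 * x ^ 3 + b₂ * x ^ 2 + 2 * b₄ * x + b₆) +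
        t * (4 * t ^ 2 + (b₂ + 12 * x) * t + 2 * (b₄ + x * b₂ + 6 * x ^ 2)) := by
  ring

/-- The duplication identity behind `x(2R) = x(T)`: with `f` the 2-division cubic, `f′` its derivative,
`f′(r)² − 16 f(r)(x + b₂/4 + 2r) = 4(2(r − x)² − (b₄ + x b₂ + 6x²))² − 4(8r + 4x + b₂)·f(x)`.
[cite: SilvermanAEC2009, III.2.3 (d) (duplication formula)] -/
theorem duplication_identity {R : Type*} [CommRing R] (b₂ b₄ b₆ x r : R) :
    (12 * r ^ 2 + 2 * b₂ * r + 2 * b₄) ^ 2 -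
        (4 * r ^ 3 + b₂ * r ^ 2 + 2 * b₄ * r + b₆) * (4 * b₂ + 32 * r) - 16 * x *
          (4 * r ^ 3 + b₂ * r ^ 2 + 2 * b₄ * r + b₆) =
      4 * (2 * (r - x) ^ 2 - (b₄ + x * b₂ + 6 * x ^ 2)) ^ 2 -
        4 * (8 * r + 4 * x + b₂) * (4 * x ^ 3 + b₂ * x ^ 2 + 2 * b₄ * x + b₆) := by
  ring

/-- **Least root from a negative value at a half.** If `x` is a root of the real cubic
`f(r) = 4r³ + b₂r² + 2b₄r + b₆`, `2t² = b₄ + x b₂ + 6x²` and `f(x + t) < 0`, then `x` is the least real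
root of `f`.  [Other roots are `x + τ` with `4τ² + ατ + 2β = 0` (`α = b₂ + 12x`, `β = 2t²`); for `τ < 0`
this gives `(α + 8t)(−τ) = 4(τ − t)² ≥ 0`, while `f(x + t) = t²(α + 8t) < 0`.] [folklore] -/
theorem least_root_of_neg_at_half {b₂ b₄ b₆ x t : ℝ}
    (hx : 4 * x ^ 3 + b₂ * x ^ 2 + 2 * b₄ * x + b₆ = 0)
    (ht : 2 * t ^ 2 = b₄ + x * b₂ + 6 * x ^ 2)
    (hneg : 4 * (x + t) ^ 3 + b₂ * (x + t) ^ 2 + 2 * b₄ * (x + t) + b₆ < 0) :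
    ∀ ρ : ℝ, 4 * ρ ^ 3 + b₂ * ρ ^ 2 + 2 * b₄ * ρ + b₆ = 0 → x ≤ ρ := by
  intro ρ hρ
  by_contra hlt
  push Not at hlt
  set τ := ρ - x with hτ
  have hτneg : τ < 0 := by rw [hτ]; linarith
  have hρ' : ρ = x + τ := by rw [hτ]; ring
  rw [hρ', cubic_shift, hx, zero_add] at hρ
  -- `τ ≠ 0`, so the quadratic factor vanishes
  have hq : 4 * τ ^ 2 + (b₂ + 12 * x) * τ + 2 * (b₄ + x * b₂ + 6 * x ^ 2) = 0 := by
    rcases mul_eq_zero.mp hρ with h | h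
    · exact absurd h hτneg.ne
    · exact h
  rw [cubic_shift, hx, zero_add, ← ht] at hneg
  rw [← ht] at hq
  -- `hneg : t * (4t² + αt + 4t²) < 0`, `hq : 4τ² + ατ + 4t² = 0`
  have h1 : t ^ 2 * ((b₂ + 12 * x) + 8 * t) < 0 := by nlinarith [hneg]
  have h2 : 0 ≤ (b₂ + 12 * x) + 8 * t := by
    have h3 : ((b₂ + 12 * x) + 8 * t) * (-τ) = 4 * (τ - t) ^ 2 := by nlinarith [hq]
    have h4 : 0 < -τ := by linarith
    nlinarith [sq_nonneg (τ - t), h3, h4]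
  nlinarith [sq_nonneg t, h1, h2]

/-! ### §1 The doubling formula: `x(R + R) = x ⟺ 2(x(R) − x)² = b₄ + x b₂ + 6x²` for a 2-torsion abscissa `x` -/

section Doubling

variable {F : Type*} [Field F] [CharZero F] (V : WeierstrassCurve F)

omit [CharZero F] in
/-- `(2s + a₁r + a₃)² = 4r³ + b₂r² + 2b₄r + b₆` on the curve. [cite: SilvermanAEC2009, III.2.3 (b) (ψ₂²)] -/
theorem sq_eq_cubic_of_equation {r s : F} (h : V.toAffine.Equation r s) :
    (2 * s + V.a₁ * r + V.a₃) ^ 2 = 4 * r ^ 3 + V.b₂ * r ^ 2 + 2 * V.b₄ * r + V.b₆ := by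
  rw [WeierstrassCurve.Affine.equation_iff] at h
  simp only [WeierstrassCurve.b₂, WeierstrassCurve.b₄, WeierstrassCurve.b₆]
  linear_combination 4 * h

omit [CharZero F] in
/-- `s − negY r s = 2s + a₁r + a₃`. [folklore] -/
theorem sub_negY_eq {r s : F} : s - V.toAffine.negY r s = 2 * s + V.a₁ * r + V.a₃ := by
  rw [WeierstrassCurve.Affine.negY]; ring

/-- **Doubling, `x`-coordinate.** For an affine point `R = (r, s)` with `2s + a₁r + a₃ ≠ 0` and a root `x`
of the 2-division cubic: `x(R + R) = x ⟺ 2(r − x)² = b₄ + x b₂ + 6x²` (the two halves-abscissae of the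
2-torsion point with abscissa `x` are `x ± √((b₄ + x b₂ + 6x²)/2)`).
[cite: SilvermanAEC2009, III.2.3 (d)] -/
theorem addX_self_eq_iff {r s : F} (h : V.toAffine.Equation r s) (hw : s ≠ V.toAffine.negY r s) {x : F}
    (hx : 4 * x ^ 3 + V.b₂ * x ^ 2 + 2 * V.b₄ * x + V.b₆ = 0) :
    V.toAffine.addX r r (V.toAffine.slope r r s s) = x ↔ 2 * (r - x) ^ 2 = V.b₄ + x * V.b₂ + 6 * x ^ 2 := by
  have hw' : 2 * s + V.a₁ * r + V.a₃ ≠ 0 := by rw [← sub_negY_eq]; exact sub_ne_zero.mpr hw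
  have hsq := sq_eq_cubic_of_equation V h
  rw [WeierstrassCurve.Affine.slope_of_Y_ne rfl hw, sub_negY_eq]
  set w := 2 * s + V.a₁ * r + V.a₃ with hwdef
  -- `16 w² · addX = f′(r)² − w²(4b₂ + 32r)`
  have key : V.toAffine.addX r r ((3 * r ^ 2 + 2 * V.a₂ * r + V.a₄ - V.a₁ * s) / w) * w ^ 2 * 16 =
      (12 * r ^ 2 + 2 * V.b₂ * r + 2 * V.b₄) ^ 2 - w ^ 2 * (4 * V.b₂ + 32 * r) := by
    simp only [WeierstrassCurve.Affine.addX, WeierstrassCurve.b₂, WeierstrassCurve.b₄]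
    field_simp
    rw [hwdef]
    ring
  have hid := duplication_identity V.b₂ V.b₄ V.b₆ x r
  rw [hx, mul_zero, sub_zero, ← hsq] at hid
  constructor
  · intro hX
    rw [hX] at key
    have h0 : 4 * (2 * (r - x) ^ 2 - (V.b₄ + x * V.b₂ + 6 * x ^ 2)) ^ 2 = 0 := by
      rw [← hid]; linear_combination key.symm
    have h1 : 2 * (r - x) ^ 2 - (V.b₄ + x * V.b₂ + 6 * x ^ 2) = 0 := by
      have := mul_eq_zero.mp h0
      rcases this with h4 | h
      · norm_num at h4
      · exact pow_eq_zero_iff (n := 2) two_ne_zero |>.mp h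
    linear_combination h1
  · intro ht
    have h0 : (12 * r ^ 2 + 2 * V.b₂ * r + 2 * V.b₄) ^ 2 - w ^ 2 * (4 * V.b₂ + 32 * r) -
        16 * x * w ^ 2 = 0 := by
      rw [hid, ← ht]; ring
    have hw2 : w ^ 2 * 16 ≠ 0 := mul_ne_zero (pow_ne_zero 2 hw') (by norm_num)
    apply mul_right_cancel₀ hw2
    linear_combination key + h0

omit [CharZero F] in
/-- A point with the abscissa of a 2-torsion point IS that point: if `(x, y)` lies on the curve with
`2y + a₁x + a₃ = 0` and `(x, y₁)` lies on the curve, then `y₁ = y`. [cite: SilvermanAEC2009, III.2.3] -/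
theorem eq_of_equation_of_two_torsion {x y y₁ : F} (h : V.toAffine.Equation x y)
    (h2 : 2 * y + V.a₁ * x + V.a₃ = 0) (h₁ : V.toAffine.Equation x y₁) : y₁ = y := by
  rw [WeierstrassCurve.Affine.equation_iff] at h h₁
  have hsq : (y₁ - y) ^ 2 = 0 := by linear_combination h₁ - h - (y₁ - y) * h2
  exact sub_eq_zero.mp (pow_eq_zero_iff (n := 2) two_ne_zero |>.mp hsq)

end Doubling

end Summit.BirchSwinnertonDyer.BirchSwinnertonDyer.Theorems.DepletionAtTwo.ArchTransport

end
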